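import Mathlib
import Literature.Probability.RandomMatrix.SphereCoordinateDensity
import HarnessLib

/-!
# Coordinate `ℓ²` norms: Cauchy–Schwarz, Parseval and Bessel for orthonormal coordinate families

Elementary Hilbert-space facts for finite coordinate vectors `ι → ℂ` with the tree's `nsq v = Σ ‖v x‖²`
(`Literature.Probability.RandomMatrix.nsq`, reused), stated without the
`EuclideanSpace` wrapper so that they compose with `Matrix.mulVec` / `dotProduct` computations:
Cauchy–Schwarz `|Σ conj(a) b|² ≤ nsq a · nsq b`, the triangle inequality for `√nsq`, `nsq (Σ d_j b_j) = Σ |d_j|²` and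
Parseval for an orthonormal coordinate family, and BESSEL's inequality for a pairwise orthogonal family of vectors of
norm `≤ 1` (zeros allowed).  Textbook (e.g. Horn–Johnson, *Matrix Analysis*, §0.6, §5.1; Mathlib:
`Orthonormal.sum_inner_products_le`, `norm_sum_le`, `Finset.sum_mul_sq_le_sq_mul_sq`, here transported to coordinates).
-/

noncomputable section

open scoped BigOperators ComplexConjugate ComplexOrder
open _root_.Matrix

namespace Literature.LinearAlgebra.Matrix

open Literature.Probability.RandomMatrix (nsq nsq_nonneg)

/-! ## Coordinate norms -/

section Nsq

variable {ι : Type*} [Fintype ι]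

/-- `nsq` is the squared Euclidean norm. [folklore] -/
theorem nsq_eq_norm_sq (v : ι → ℂ) : nsq v = ‖WithLp.toLp 2 v‖ ^ 2 := by
  rw [EuclideanSpace.norm_sq_eq]; rfl

/-- `√nsq` is the Euclidean norm. [folklore] -/
theorem sqrt_nsq_eq_norm (v : ι → ℂ) : Real.sqrt (nsq v) = ‖WithLp.toLp 2 v‖ := by
  rw [nsq_eq_norm_sq, Real.sqrt_sq (norm_nonneg _)]

/-- Triangle inequality for `√nsq` over a finite sum of vectors. [folklore] -/
theorem sqrt_nsq_sum_le {κ : Type*} (s : Finset κ) (v : κ → ι → ℂ) :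
    Real.sqrt (nsq (∑ j ∈ s, v j)) ≤ ∑ j ∈ s, Real.sqrt (nsq (v j)) := by
  rw [sqrt_nsq_eq_norm, WithLp.toLp_sum]
  refine (norm_sum_le s _).trans (le_of_eq ?_)
  exact Finset.sum_congr rfl fun j _ => (sqrt_nsq_eq_norm (v j)).symm

/-- Cauchy–Schwarz in coordinates: `|Σ conj(a) b|² ≤ nsq a · nsq b`. [folklore] -/
theorem norm_sum_conj_mul_sq_le (a b : ι → ℂ) :
    ‖∑ x, conj (a x) * b x‖ ^ 2 ≤ nsq a * nsq b := by
  have h1 : ‖∑ x, conj (a x) * b x‖ ≤ ∑ x, ‖a x‖ * ‖b x‖ := by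
    calc ‖∑ x, conj (a x) * b x‖ ≤ ∑ x, ‖conj (a x) * b x‖ := norm_sum_le _ _
      _ = ∑ x, ‖a x‖ * ‖b x‖ := by simp_rw [norm_mul, Complex.norm_conj]
  calc ‖∑ x, conj (a x) * b x‖ ^ 2 ≤ (∑ x, ‖a x‖ * ‖b x‖) ^ 2 :=
        pow_le_pow_left₀ (norm_nonneg _) h1 2
    _ ≤ (∑ x, ‖a x‖ ^ 2) * ∑ x, ‖b x‖ ^ 2 := Finset.sum_mul_sq_le_sq_mul_sq _ _ _
    _ = nsq a * nsq b := rfl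

/-- `nsq` of a scalar multiple. [folklore] -/
theorem nsq_complex_smul (c : ℂ) (v : ι → ℂ) : nsq (c • v) = ‖c‖ ^ 2 * nsq v := by
  unfold nsq
  rw [Finset.mul_sum]
  refine Finset.sum_congr rfl fun x _ => ?_
  rw [Pi.smul_apply, smul_eq_mul, norm_mul, mul_pow]

/-- The complex form of `nsq`: `Σ conj(v) v = nsq v`. [folklore] -/
theorem sum_conj_mul_self (v : ι → ℂ) : (∑ x, conj (v x) * v x) = ((nsq v : ℝ) : ℂ) := by
  unfold nsq
  rw [Complex.ofReal_sum]
  refine Finset.sum_congr rfl fun x _ => ?_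
  rw [mul_comm, Complex.mul_conj, Complex.normSq_eq_norm_sq, Complex.ofReal_pow]

end Nsq

/-! ## Orthonormal coordinate frames of `ℂ^m` (as delivered by `eigvec_orthonormal` / `eigvec_expand`) -/

section Frame

variable {m : Type*} [Fintype m]

/-- `nsq` of a combination of an orthonormal coordinate family is the sum of the squared coefficients. [folklore] -/
theorem nsq_sum_smul_of_orthonormal {κ : Type*} [Fintype κ] [DecidableEq κ] (b : κ → m → ℂ)
    (hb : ∀ j k, (∑ μ, conj (b j μ) * b k μ) = if j = k then 1 else 0) (d : κ → ℂ) :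
    nsq (∑ j, d j • b j) = ∑ j, ‖d j‖ ^ 2 := by
  have hC : (∑ μ, conj ((∑ j, d j • b j) μ) * (∑ j, d j • b j) μ) = ∑ j, conj (d j) * d j := by
    calc (∑ μ, conj ((∑ j, d j • b j) μ) * (∑ j, d j • b j) μ)
        = ∑ μ, ∑ j, ∑ k, conj (d j) * d k * (conj (b j μ) * b k μ) := by
          refine Finset.sum_congr rfl fun μ _ => ?_
          have happ : (∑ j, d j • b j) μ = ∑ j, d j * b j μ := by
            simp only [Finset.sum_apply, Pi.smul_apply, smul_eq_mul]
          rw [happ, map_sum, Finset.sum_mul]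
          refine Finset.sum_congr rfl fun j _ => ?_
          rw [map_mul, Finset.mul_sum]
          refine Finset.sum_congr rfl fun k _ => ?_
          ring
      _ = ∑ j, ∑ k, conj (d j) * d k * ∑ μ, conj (b j μ) * b k μ := by
          rw [Finset.sum_comm]
          refine Finset.sum_congr rfl fun j _ => ?_
          rw [Finset.sum_comm]
          refine Finset.sum_congr rfl fun k _ => ?_
          rw [Finset.mul_sum]
      _ = ∑ j, conj (d j) * d j := by
          refine Finset.sum_congr rfl fun j _ => ?_
          simp_rw [hb, mul_ite, mul_one, mul_zero]
          rw [Finset.sum_ite_eq]; simp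
  rw [sum_conj_mul_self] at hC
  simp_rw [Complex.conj_mul'] at hC
  exact_mod_cast hC

/-- Parseval for an orthonormal coordinate family that spans: `nsq w = Σ_j |⟨b_j, w⟩|²`. [folklore] -/
theorem nsq_eq_sum_of_orthonormal {κ : Type*} [Fintype κ] [DecidableEq κ] (b : κ → m → ℂ)
    (hb : ∀ j k, (∑ μ, conj (b j μ) * b k μ) = if j = k then 1 else 0)
    (w : m → ℂ) (hw : w = ∑ j, (∑ μ, conj (b j μ) * w μ) • b j) :
    nsq w = ∑ j, ‖∑ μ, conj (b j μ) * w μ‖ ^ 2 := by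
  conv_lhs => rw [hw]
  exact nsq_sum_smul_of_orthonormal b hb _

/-- Bessel in coordinates for a pairwise orthogonal family of vectors of `nsq ≤ 1` (zeros allowed):
`Σ_j |⟨y_j, x⟩|² ≤ nsq x`. [folklore] -/
theorem bessel_suborthonormal {κ : Type*} [Fintype κ] (y : κ → m → ℂ)
    (hyo : ∀ j k, j ≠ k → (∑ μ, conj (y j μ) * y k μ) = 0) (hyn : ∀ j, nsq (y j) ≤ 1) (x : m → ℂ) :
    (∑ j, ‖∑ μ, conj (y j μ) * x μ‖ ^ 2) ≤ nsq x := by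
  classical
  set c : κ → ℂ := fun j => ∑ μ, conj (y j μ) * x μ with hc
  set p : m → ℂ := fun μ => ∑ j, c j * y j μ with hp
  -- the three scalar products
  have hxp : (∑ μ, conj (x μ) * p μ) = ∑ j, c j * conj (c j) := by
    calc (∑ μ, conj (x μ) * p μ) = ∑ μ, ∑ j, c j * (conj (x μ) * y j μ) := by
          refine Finset.sum_congr rfl fun μ _ => ?_
          rw [hp, Finset.mul_sum]
          exact Finset.sum_congr rfl fun j _ => by ring
      _ = ∑ j, c j * ∑ μ, conj (x μ) * y j μ := by
          rw [Finset.sum_comm]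
          exact Finset.sum_congr rfl fun j _ => by rw [Finset.mul_sum]
      _ = ∑ j, c j * conj (c j) := by
          refine Finset.sum_congr rfl fun j _ => ?_
          congr 1
          rw [hc, map_sum]
          exact Finset.sum_congr rfl fun μ _ => by rw [map_mul, Complex.conj_conj, mul_comm]
  have hpp : (∑ μ, conj (p μ) * p μ) = ∑ j, conj (c j) * c j * ((nsq (y j) : ℝ) : ℂ) := by
    calc (∑ μ, conj (p μ) * p μ) = ∑ μ, ∑ j, ∑ k, conj (c j) * c k * (conj (y j μ) * y k μ) := by
          refine Finset.sum_congr rfl fun μ _ => ?_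
          rw [hp, map_sum, Finset.sum_mul]
          refine Finset.sum_congr rfl fun j _ => ?_
          rw [map_mul, Finset.mul_sum]
          exact Finset.sum_congr rfl fun k _ => by ring
      _ = ∑ j, ∑ k, conj (c j) * c k * ∑ μ, conj (y j μ) * y k μ := by
          rw [Finset.sum_comm]
          refine Finset.sum_congr rfl fun j _ => ?_
          rw [Finset.sum_comm]
          exact Finset.sum_congr rfl fun k _ =>
            (Finset.mul_sum Finset.univ (fun μ => conj (y j μ) * y k μ) (conj (c j) * c k)).symm
      _ = ∑ j, conj (c j) * c j * ((nsq (y j) : ℝ) : ℂ) := by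
          refine Finset.sum_congr rfl fun j _ => ?_
          rw [Finset.sum_eq_single j]
          · rw [sum_conj_mul_self]
          · intro k _ hk; rw [hyo j k (Ne.symm hk), mul_zero]
          · intro h; exact absurd (Finset.mem_univ _) h
  -- 0 ≤ nsq (x - p) = nsq x - 2 S + S'  with  S' ≤ S
  have hS : (∑ j, c j * conj (c j)) = (((∑ j, ‖c j‖ ^ 2 : ℝ)) : ℂ) := by
    rw [Complex.ofReal_sum]
    exact Finset.sum_congr rfl fun j _ => by
      rw [Complex.mul_conj, Complex.normSq_eq_norm_sq, Complex.ofReal_pow]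
  have hS'le : (∑ j, ‖c j‖ ^ 2 * nsq (y j)) ≤ ∑ j, ‖c j‖ ^ 2 :=
    Finset.sum_le_sum fun j _ => by
      simpa using mul_le_mul_of_nonneg_left (hyn j) (sq_nonneg ‖c j‖)
  have hexp : nsq (x - p) = nsq x - 2 * (∑ j, ‖c j‖ ^ 2) + ∑ j, ‖c j‖ ^ 2 * nsq (y j) := by
    have h1 : (((nsq (x - p)) : ℝ) : ℂ) = ((nsq x : ℝ) : ℂ) - 2 * (((∑ j, ‖c j‖ ^ 2 : ℝ)) : ℂ) +
        (((∑ j, ‖c j‖ ^ 2 * nsq (y j) : ℝ)) : ℂ) := by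
      rw [← sum_conj_mul_self, ← sum_conj_mul_self]
      have hpx : (∑ μ, conj (p μ) * x μ) = ∑ j, c j * conj (c j) := by
        have := congrArg conj hxp
        rw [map_sum, map_sum] at this
        simp only [map_mul, Complex.conj_conj] at this
        rw [show (∑ μ, conj (p μ) * x μ) = ∑ μ, x μ * conj (p μ) from
          Finset.sum_congr rfl fun μ _ => mul_comm _ _, this]
        exact Finset.sum_congr rfl fun j _ => mul_comm _ _
      have hS'' : (∑ j, conj (c j) * c j * ((nsq (y j) : ℝ) : ℂ)) =
          (((∑ j, ‖c j‖ ^ 2 * nsq (y j) : ℝ)) : ℂ) := by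
        rw [Complex.ofReal_sum]
        exact Finset.sum_congr rfl fun j _ => by
          rw [mul_comm (conj (c j)), Complex.mul_conj, Complex.normSq_eq_norm_sq]; push_cast; ring
      calc (∑ μ, conj ((x - p) μ) * (x - p) μ)
          = (∑ μ, conj (x μ) * x μ) - (∑ μ, conj (x μ) * p μ) - (∑ μ, conj (p μ) * x μ)
              + ∑ μ, conj (p μ) * p μ := by
            simp only [Pi.sub_apply, map_sub, ← Finset.sum_sub_distrib, ← Finset.sum_add_distrib]
            exact Finset.sum_congr rfl fun μ _ => by ring
        _ = _ := by rw [hxp, hpx, hpp, hS, hS'']; ring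
    exact_mod_cast h1
  have h0 : 0 ≤ nsq (x - p) := nsq_nonneg _
  linarith

end Frame

end Literature.LinearAlgebra.Matrix

end
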